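import Summits.RiemannHypothesis.RiemannHypothesis.Theorems.UniversalFactorLehmerCoreBounds

/-!
# RiemannHypothesis / UniversalFactor — certified enclosures of the explicit factor of the
Lehmer-pair certificate (`lehmerF t₀ κ (½ + it)` at rational `t`)

Route `RiemannHypothesis/UniversalFactor`, item `LehmerPointNoGo` (stmt-RiemannHypothesis-2582).
Executable interval arithmetic (the multi-precision intervals `MI`/`MC` of
`Literature/Analysis/ValidatedNumerics/MultiPrecisionInterval.lean` and the certified evaluator
`zetaBox` of `ZetaCertifiedEvaluation.lean`) for the quantities entering `UniversalFactor.lehmer_cell`: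

* `UniversalFactor.atanSmall` / `mem_atanSmall` — `arctan(p/q)` for `2p ≤ q` (two Gregory terms);
* `UniversalFactor.stirlingPrim_thetaArg` — `F(¼ + it/2)` in real terms:
  `Re = −ℓ/4 − tα/2 − ¼`, `Im = −α/4 + tℓ/2 − t/2`, `ℓ = ½ log(1/16 + t²/4)`, `α = π/2 − arctan(1/(2t))`;
* `UniversalFactor.spOf` / `mem_spOf` — enclosures of `Re F(¼+it/2)`, `Im F(¼+it/2)` at `t = a/b`;

The evaluation context and the box for `lehmerF t₀ κ (½ + it)` itself are in
`UniversalFactorLehmerFactorBox.lean`. Everything is proved.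
-/

set_option linter.dupNamespace false

namespace Summit.RiemannHypothesis.RiemannHypothesis.Theorems

open Complex Real Finset
open Literature.Analysis.ValidatedNumerics Literature.Analysis.ValidatedNumerics.NumericsMP
open Literature.NumberTheory.LFunctions Literature.NumberTheory.LFunctions.ZetaNumerics
open Literature.Analysis.SpecialFunctions.Complex (stirlingPrim)

/-! ## Small arctangents -/

/-- Soundness of `atanSmall`. [folklore] -/
theorem UniversalFactor.mem_atanSmall (S : ℕ) {p q : ℕ} (hq : 0 < q) (hpq : 2 * p ≤ q) :
    MI.mem S (Real.arctan ((p : ℝ) / q)) (UniversalFactor.atanSmall S p q) := by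
  unfold UniversalFactor.atanSmall
  set x : ℝ := (p : ℝ) / q with hx
  have hqr : (0 : ℝ) < q := by exact_mod_cast hq
  have hx0 : 0 ≤ x := by positivity
  have hx2 : x ≤ 1 / 2 := by
    rw [hx, div_le_iff₀ hqr]
    have : (2 * p : ℝ) ≤ q := by exact_mod_cast hpq
    linarith
  have hx1 : x < 1 := by linarith
  have hsum := MI.abs_arctan_sub_sum_le hx0 hx1 2
  have hs : ∑ i ∈ range 2, (-1 : ℝ) ^ i * x ^ (2 * i + 1) / ((2 * i + 1 : ℕ) : ℝ) = x - x ^ 3 / 3 := by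
    simp [Finset.sum_range_succ]; ring
  rw [hs] at hsum
  have hfrac : MI.mem S (x - x ^ 3 / 3)
      (MI.ofFrac S (3 * (p : ℤ) * (q : ℤ) ^ 2 - (p : ℤ) ^ 3) (3 * q ^ 3)) := by
    have h := MI.mem_ofFrac S (3 * (p : ℤ) * (q : ℤ) ^ 2 - (p : ℤ) ^ 3) (q := 3 * q ^ 3) (by positivity)
    convert h using 1
    rw [hx]; push_cast; field_simp
  refine MI.mem_widen hfrac ?_
  -- `|arctan x - (x - x³/3)| ≤ x⁵/(1-x²) ≤ 2 x⁵`
  have htail : |Real.arctan x - (x - x ^ 3 / 3)| ≤ 2 * x ^ 5 := by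
    rw [show 2 * 2 + 1 = 5 by norm_num] at hsum
    refine hsum.trans ?_
    have hden : (3:ℝ) / 4 ≤ 1 - x ^ 2 := by nlinarith
    have h5 : 0 ≤ x ^ 5 := pow_nonneg hx0 5
    rw [div_le_iff₀ (by linarith)]
    have := mul_le_mul_of_nonneg_left hden h5
    nlinarith
  have hS : (0:ℝ) ≤ S := by positivity
  have h1 : |Real.arctan x - (x - x ^ 3 / 3)| * S ≤ 2 * (S : ℝ) * (p : ℝ) ^ 5 / (q : ℝ) ^ 5 := by
    calc _ ≤ 2 * x ^ 5 * S := mul_le_mul_of_nonneg_right htail hS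
      _ = _ := by rw [hx, div_pow]; ring
  refine h1.trans ?_
  have := Numerics.div_le_cdiv (a := 2 * (S : ℤ) * (p : ℤ) ^ 5) (b := (q : ℤ) ^ 5) (by positivity)
  push_cast at this
  exact this

/-! ## The Stirling primitive on the line `Re w = ¼` -/

/-- `‖¼ + it/2‖ = √(1 + 4t²)/4`. [folklore] -/
theorem UniversalFactor.norm_thetaArg (t : ℝ) : ‖thetaArg t‖ = Real.sqrt (1 + 4 * t ^ 2) / 4 := by
  rw [show thetaArg t = ((1 / 4 : ℝ) : ℂ) + ((t / 2 : ℝ) : ℂ) * I by simp only [thetaArg]; push_cast; ring,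
    Complex.norm_add_mul_I, show (1 / 4 : ℝ) ^ 2 + (t / 2) ^ 2 = (1 + 4 * t ^ 2) / 16 by ring,
    Real.sqrt_div' _ (by norm_num : (0:ℝ) ≤ 16), show (16 : ℝ) = 4 ^ 2 by norm_num,
    Real.sqrt_sq (by norm_num : (0:ℝ) ≤ 4)]

/-- `arg(¼ + it/2) = π/2 − arctan(1/(2t))` for `t > 0`. [folklore] -/
theorem UniversalFactor.arg_thetaArg {t : ℝ} (ht : 0 < t) :
    Complex.arg (thetaArg t) = π / 2 - Real.arctan (1 / (2 * t)) := by
  rw [Complex.arg_of_re_nonneg (by simp), thetaArg_im, UniversalFactor.norm_thetaArg]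
  have hs : 0 < Real.sqrt (1 + 4 * t ^ 2) := Real.sqrt_pos.2 (by positivity)
  have e : t / 2 / (Real.sqrt (1 + 4 * t ^ 2) / 4) = (2 * t) / Real.sqrt (1 + (2 * t) ^ 2) := by
    rw [show (2 * t) ^ 2 = 4 * t ^ 2 by ring]
    field_simp
    ring
  rw [e, ← Real.arctan_eq_arcsin, one_div, Real.arctan_inv_of_pos (by positivity)]
  ring

/-- **`F(¼ + it/2)` in real terms** (`t > 0`): `F(w) = (w − ½) Log w − w` with
`Log w = ℓ(t) + iα(t)`. [folklore] -/
theorem UniversalFactor.stirlingPrim_thetaArg {t : ℝ} (ht : 0 < t) :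
    stirlingPrim (thetaArg t) = ((UniversalFactor.reSPR t : ℝ) : ℂ) + ((UniversalFactor.imSPR t : ℝ) : ℂ) * I := by
  have hlog : Complex.log (thetaArg t) = ((UniversalFactor.ellR t : ℝ) : ℂ) + ((UniversalFactor.alphaR t : ℝ) : ℂ) * I := by
    apply Complex.ext
    · simp only [Complex.log_re, Complex.add_re, Complex.ofReal_re, Complex.mul_re, Complex.I_re,
        Complex.ofReal_im, Complex.I_im, mul_zero, mul_one, sub_self, add_zero]
      rw [UniversalFactor.norm_thetaArg, UniversalFactor.ellR, Real.log_div (Real.sqrt_pos.2 (by positivity)).ne'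
        (by norm_num), Real.log_sqrt (by positivity)]
      have : Real.log (1 / 16 + t ^ 2 / 4) = Real.log (1 + 4 * t ^ 2) - Real.log 16 := by
        rw [← Real.log_div (by positivity) (by norm_num)]; congr 1; ring
      rw [this, show (16 : ℝ) = 4 ^ 2 by norm_num, Real.log_pow]; push_cast; ring
    · simp only [Complex.log_im, Complex.add_im, Complex.ofReal_im, Complex.mul_im, Complex.I_re,
        Complex.ofReal_re, Complex.I_im, mul_zero, mul_one, zero_add, add_zero]
      rw [UniversalFactor.arg_thetaArg ht, UniversalFactor.alphaR]
  rw [stirlingPrim, hlog]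
  apply Complex.ext
  · simp [thetaArg, UniversalFactor.reSPR]; ring
  · simp [thetaArg, UniversalFactor.imSPR]; ring

/-! ## Enclosures of `ℓ`, `α`, `Re F`, `Im F` at rational `t = a/b` -/

/-- Soundness of `ellOf`. [folklore] -/
theorem UniversalFactor.mem_ellOf {S K a b : ℕ} (hS : 0 < S) (hb : 0 < b) {L : MI}
    (h : UniversalFactor.ellOf S K a b = some L) : MI.mem S (UniversalFactor.ellR ((a : ℝ) / b)) L := by
  unfold UniversalFactor.ellOf at h
  split at h
  · rename_i L1 L2 h1 h2
    simp only [Option.some.injEq] at h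
    subst h
    have m1 := MI.mem_logNat hS h1
    have m2 := MI.mem_logNat hS h2
    have e : UniversalFactor.ellR ((a : ℝ) / b) = (Real.log ((b ^ 2 + 4 * a ^ 2 : ℕ) : ℝ) -
        Real.log ((16 * b ^ 2 : ℕ) : ℝ)) / 2 := by
      have hbr : (0 : ℝ) < b := by exact_mod_cast hb
      rw [UniversalFactor.ellR, ← Real.log_div (by positivity) (by positivity)]
      congr 2
      push_cast
      field_simp
      ring
    rw [e]
    exact MI.mem_divNat (MI.mem_sub m1 m2) (by norm_num)
  · simp at h

/-- Soundness of `alphaOf`. [folklore] -/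
theorem UniversalFactor.mem_alphaOf {S a b : ℕ} {piI : MI} (hpi : MI.mem S Real.pi piI) (hb : 0 < b)
    (hba : b ≤ a) : MI.mem S (UniversalFactor.alphaR ((a : ℝ) / b)) (UniversalFactor.alphaOf S piI a b) := by
  unfold UniversalFactor.alphaOf UniversalFactor.alphaR
  have ha : 0 < a := lt_of_lt_of_le hb hba
  have h := UniversalFactor.mem_atanSmall S (p := b) (q := 2 * a) (by omega) (by omega)
  have e : (1 : ℝ) / (2 * ((a : ℝ) / b)) = (b : ℝ) / ((2 * a : ℕ) : ℝ) := by
    have : (0:ℝ) < b := by exact_mod_cast hb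
    push_cast; field_simp
  rw [e]
  exact MI.mem_sub (MI.mem_divNat hpi (by norm_num)) h

/-- Soundness of `spOf`. [folklore] -/
theorem UniversalFactor.mem_spOf {S K a b : ℕ} {piI : MI} (hS : 0 < S) (hpi : MI.mem S Real.pi piI)
    (hb : 0 < b) (hba : b ≤ a) {P : MI × MI} (h : UniversalFactor.spOf S K piI a b = some P) :
    MI.mem S (UniversalFactor.reSPR ((a : ℝ) / b)) P.1 ∧ MI.mem S (UniversalFactor.imSPR ((a : ℝ) / b)) P.2 := by
  unfold UniversalFactor.spOf at h
  split at h
  · simp at h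
  · rename_i ell hell
    simp only [Option.some.injEq] at h
    subst h
    have mℓ := UniversalFactor.mem_ellOf hS hb hell
    have mα := UniversalFactor.mem_alphaOf (S := S) hpi hb hba
    have mt : MI.mem S ((a : ℝ) / b) (MI.ofFrac S a b) := by
      have := MI.mem_ofFrac S (a : ℤ) (q := b) hb
      simpa using this
    have m14 : MI.mem S ((1 : ℝ) / 4) (MI.ofFrac S 1 4) := by
      have := MI.mem_ofFrac S (1 : ℤ) (q := 4) (by norm_num)
      simpa using this
    constructor
    · have := MI.mem_sub (MI.mem_sub (MI.mem_neg (MI.mem_divNat mℓ (by norm_num : 0 < 4)))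
        (MI.mem_divNat (MI.mem_mul hS mt mα) (by norm_num : 0 < 2))) m14
      convert this using 1
      simp only [UniversalFactor.reSPR]; push_cast; ring
    · have := MI.mem_sub (MI.mem_add (MI.mem_neg (MI.mem_divNat mα (by norm_num : 0 < 4)))
        (MI.mem_divNat (MI.mem_mul hS mt mℓ) (by norm_num : 0 < 2))) (MI.mem_divNat mt (by norm_num : 0 < 2))
      convert this using 1
      simp only [UniversalFactor.imSPR]; push_cast; ring

end Summit.RiemannHypothesis.RiemannHypothesis.Theorems
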